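import Summits.QuantumFields.YangMills.Theorems.SandwichVariancePinchingFloorMollification
import Summits.QuantumFields.YangMills.Theorems.SandwichVariancePinchingCeilingSmooth

/-!
# Route `SandwichVariancePinching` — crux `QuadraticVarianceCeiling` (stmt-QuantumFields-28259):
# **MOLLIFICATION** — the variance ceiling in the whitened frame for a CONTINUOUS potential

`ceilingWhitened`: `gE(q²) − gE(q)² ≤ (1 + 26δ)(2 tr H² + |b|²)` for every CONTINUOUS centred potential with the
Euclidean second-difference sandwich, `0 ≤ δ ≤ 1/2` — from the smooth ceiling `…CeilingSmooth.ceilingWhitened_of_contDiff`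
by the mollification / recentring / limit argument of `…FloorMollification` (normed-bump convolution keeps the
sandwich; Gibbs moments converge by dominated convergence; the mean `m_k → 0` by the centring of `A`).

HONEST SCOPE.  Free-hands work of the LEAD seat of crux stmt-QuantumFields-22884 (cell ym-idea-1) on planner
ym-idea-3's draft-by-design sub-line; with `…CeilingWhitening` it yields the crux BY NAME (closing file
`…QuadraticVarianceCeiling.lean`); nothing here proves `LogConcaveChart.QuadraticCovarianceComparison` (26240) by
itself, the `LogConcaveChart` thesis, rung R2a or any summit statement; the Yang–Mills mass gap is NOT proved.
-/

noncomputable section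

namespace Summit.QuantumFields.YangMills.Theorems.SandwichVariancePinching

open MeasureTheory Real Filter Topology ContinuousLinearMap
open scoped Convolution

variable {n : ℕ}

open Summit.QuantumFields.YangMills.Cruxes.TransportCovarianceTransfer in
/-- **THE VARIANCE CEILING IN THE WHITENED FRAME FOR A CONTINUOUS POTENTIAL** (`C = 26`, `δ ≤ 1/2`):
mollify (`sandwich_moll`, `contDiff_moll`), recentre by the mean `m_k`, apply the smooth ceiling
`ceilingWhitened_of_contDiff` to `(H, b + 2Hm_k)`, pass to the limit (`tendsto_integral_moll`, `m_k → 0`).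
[folklore] -/
theorem ceilingWhitened {δ : ℝ} (hδ : 0 ≤ δ) (hδ2 : δ ≤ 1 / 2)
    (H : Matrix (Fin n) (Fin n) ℝ) (b : Fin n → ℝ) {A : (Fin n → ℝ) → ℝ} (hH : H.IsSymm)
    (hA : Continuous A)
    (hsw : ∀ x h : Fin n → ℝ, (1 - δ) * (h ⬝ᵥ h) ≤ A (x + h) + A (x - h) - 2 * A x ∧
      A (x + h) + A (x - h) - 2 * A x ≤ (1 + δ) * (h ⬝ᵥ h))
    (hcent : ∀ i : Fin n, ∫ x, x i * exp (-A x) = 0) :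
    (∫ x, (x ⬝ᵥ H.mulVec x + b ⬝ᵥ x) * (x ⬝ᵥ H.mulVec x + b ⬝ᵥ x) * exp (-A x)) / (∫ x, exp (-A x)) -
        (∫ x, (x ⬝ᵥ H.mulVec x + b ⬝ᵥ x) * exp (-A x)) / (∫ x, exp (-A x)) *
          ((∫ x, (x ⬝ᵥ H.mulVec x + b ⬝ᵥ x) * exp (-A x)) / (∫ x, exp (-A x))) ≤
      (1 + 26 * δ) * (2 * (H * H).trace + b ⬝ᵥ b) := by
  have hδ1 : δ < 1 := by linarith
  obtain ⟨C₀, κ, hC₀, hκ, hlb⟩ := exists_quadratic_lower_of_sandwich hA hδ1 hsw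
  -- the observable and its growth
  set q : (Fin n → ℝ) → ℝ := fun x => x ⬝ᵥ H.mulVec x + b ⬝ᵥ x with hqdef
  have hqc : Continuous q := (contDiff_quadObs H b).continuous
  obtain ⟨Dq, hDq0, hDq⟩ := exists_abs_quad_le H b
  have hqb : ∀ x, |q x| ≤ Dq * (1 + ‖x‖) ^ 2 := fun x => by
    refine (hDq x).trans (mul_le_mul_of_nonneg_left ?_ hDq0)
    nlinarith [norm_nonneg x]
  have hqqb := abs_mul_le_growth hqb hqb
  -- bumps with support radius `1/(k+1)`
  have hr : ∀ k : ℕ, (0:ℝ) < 1 / (2 * ((k:ℝ) + 1)) := fun k => by positivity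
  have hr' : ∀ k : ℕ, 1 / (2 * ((k:ℝ) + 1)) < 1 / ((k:ℝ) + 1) := fun k =>
    one_div_lt_one_div_of_lt (by positivity) (by linarith [(Nat.cast_nonneg k : (0:ℝ) ≤ k)])
  set φ : ℕ → ContDiffBump (0 : Fin n → ℝ) := fun k => ⟨1 / (2 * ((k:ℝ) + 1)), 1 / ((k:ℝ) + 1), hr k, hr' k⟩
    with hφdef
  have hφout : ∀ k, (φ k).rOut = 1 / ((k:ℝ) + 1) := fun k => rfl
  have hφ : Tendsto (fun k => (φ k).rOut) atTop (𝓝 0) := by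
    simp only [hφout]; exact tendsto_one_div_add_atTop_nhds_zero_nat
  have hφ1 : ∀ k, (φ k).rOut ≤ 1 := fun k => by
    rw [hφout, div_le_one (by positivity)]; linarith [(Nat.cast_nonneg k : (0:ℝ) ≤ k)]
  -- the mollified potentials
  set Am : ℕ → (Fin n → ℝ) → ℝ := fun k => (φ k).normed volume ⋆[lsmul ℝ ℝ, volume] A with hAmdef
  have hAm2 : ∀ k, ContDiff ℝ 2 (Am k) := fun k => contDiff_moll (φ k) hA
  have hAmc : ∀ k, Continuous (Am k) := fun k => (hAm2 k).continuous
  have hswm : ∀ k (x h : Fin n → ℝ), (1 - δ) * (h ⬝ᵥ h) ≤ Am k (x + h) + Am k (x - h) - 2 * Am k x ∧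
      Am k (x + h) + Am k (x - h) - 2 * Am k x ≤ (1 + δ) * (h ⬝ᵥ h) := fun k x h =>
    sandwich_moll (φ k) hA hsw x h
  have hlbm : ∀ k x, -(2 * C₀ + 2 * κ) * (1 + ‖x‖) + κ * ‖x‖ ^ 2 ≤ Am k x := fun k x =>
    quadratic_lower_moll (φ k) (hφ1 k) hA hC₀ hκ.le hlb x
  -- moments under `e^{−A_k}` and their limits
  have hlim : ∀ {w : (Fin n → ℝ) → ℝ} {D : ℝ} {j : ℕ}, Continuous w → j ≤ 8 →
      (∀ x, |w x| ≤ D * (1 + ‖x‖) ^ j) →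
      Tendsto (fun k => ∫ x, w x * exp (-Am k x)) atTop (𝓝 (∫ x, w x * exp (-A x))) :=
    fun hw hj hwb => tendsto_integral_moll φ hφ hφ1 hA hw hC₀ hκ hj hlb hwb
  have hZlim : Tendsto (fun k => ∫ x, exp (-Am k x)) atTop (𝓝 (∫ x, exp (-A x))) := by
    have := hlim (w := fun _ => (1:ℝ)) (D := 1) (j := 0) continuous_const (by norm_num) (fun x => by simp)
    simpa using this
  have hMlim : ∀ i : Fin n, Tendsto (fun k => ∫ x, x i * exp (-Am k x)) atTop (𝓝 0) := fun i => by
    have := hlim (w := fun x => x i) (D := 1) (j := 1) (continuous_apply i) (by norm_num) (fun x => by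
      rw [pow_one]
      have : |x i| ≤ ‖x‖ := by simpa [Real.norm_eq_abs] using norm_le_pi_norm x i
      linarith [norm_nonneg x])
    rwa [hcent i] at this
  have hIqlim : Tendsto (fun k => ∫ x, q x * exp (-Am k x)) atTop (𝓝 (∫ x, q x * exp (-A x))) :=
    hlim hqc (by norm_num) hqb
  have hIqqlim : Tendsto (fun k => ∫ x, q x * q x * exp (-Am k x)) atTop
      (𝓝 (∫ x, q x * q x * exp (-A x))) :=
    hlim (hqc.mul hqc) (by norm_num) hqqb
  -- positivity of the partition functions
  have hZ : 0 < ∫ x, exp (-A x) := by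
    have := integrable_mul_exp_neg_of_growth hA continuous_const hκ (by norm_num : 0 ≤ 8) hlb
      (w := fun _ => (1:ℝ)) (D := 1) (fun x => by simp)
    exact integral_exp_pos (by simpa using this)
  have hZk : ∀ k, 0 < ∫ x, exp (-Am k x) := fun k => by
    have := integrable_mul_exp_neg_of_growth (hAmc k) continuous_const hκ (by norm_num : 0 ≤ 8) (hlbm k)
      (w := fun _ => (1:ℝ)) (D := 1) (fun x => by simp)
    exact integral_exp_pos (by simpa using this)
  -- the means and the recentred potentials
  set m : ℕ → (Fin n → ℝ) := fun k i => (∫ x, x i * exp (-Am k x)) / ∫ x, exp (-Am k x) with hmdef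
  have hmlim : Tendsto m atTop (𝓝 0) := by
    rw [tendsto_pi_nhds]
    intro i
    have h := (hMlim i).div hZlim hZ.ne'
    rw [zero_div] at h
    exact h
  set At : ℕ → (Fin n → ℝ) → ℝ := fun k y => Am k (y + m k) with hAtdef
  have hAt2 : ∀ k, ContDiff ℝ 2 (At k) := fun k => (hAm2 k).comp (contDiff_id.add contDiff_const)
  have hswt : ∀ k (y h : Fin n → ℝ), (1 - δ) * (h ⬝ᵥ h) ≤ At k (y + h) + At k (y - h) - 2 * At k y ∧
      At k (y + h) + At k (y - h) - 2 * At k y ≤ (1 + δ) * (h ⬝ᵥ h) := by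
    intro k y h
    have := hswm k (y + m k) h
    simp only [hAtdef]
    rwa [show y + h + m k = y + m k + h by abel, show y - h + m k = y + m k - h by abel]
  have hcentt : ∀ k (i : Fin n), ∫ y, y i * exp (-At k y) = 0 := by
    intro k i
    have hT := integral_add_right_eq_self (μ := (volume : Measure (Fin n → ℝ)))
      (fun x => (x i - m k i) * exp (-Am k x)) (m k)
    simp only [Pi.add_apply, add_sub_cancel_right] at hT
    -- `hT : ∫ y, y i * exp(-Am k (y + m k)) = ∫ x, (x i - m k i) * exp(-Am k x)`
    simp only [hAtdef]
    rw [hT]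
    have hI1 : Integrable fun x => x i * exp (-Am k x) :=
      integrable_mul_exp_neg_of_growth (hAmc k) (continuous_apply i) hκ (by norm_num : 1 ≤ 8) (hlbm k)
        (D := 1) (fun x => by
          rw [pow_one]
          have : |x i| ≤ ‖x‖ := by simpa [Real.norm_eq_abs] using norm_le_pi_norm x i
          linarith [norm_nonneg x])
    have hI0 : Integrable fun x => exp (-Am k x) := by
      have := integrable_mul_exp_neg_of_growth (hAmc k) continuous_const hκ (by norm_num : 0 ≤ 8) (hlbm k)
        (w := fun _ => (1:ℝ)) (D := 1) (fun x => by simp)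
      simpa using this
    have e : (fun x => (x i - m k i) * exp (-Am k x)) = fun x => x i * exp (-Am k x) - m k i * exp (-Am k x) := by
      funext x; ring
    rw [e, integral_sub hI1 (hI0.const_mul _), integral_const_mul,
      show m k i = (∫ x, x i * exp (-Am k x)) / ∫ x, exp (-Am k x) from rfl,
      div_mul_cancel₀ _ (hZk k).ne', sub_self]
  -- the smooth floor for the recentred potentials, observable `(H, b + 2Hm_k)`
  have hceil := fun k => ceilingWhitened_of_contDiff hδ hδ2 H (b + (2:ℝ) • H.mulVec (m k)) hH (hAt2 k)
    (hswt k) (hcentt k)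
  -- identify the variance under the recentred weight with the variance of `q` under `e^{−A_k}`
  have hident : ∀ k,
      (∫ y, (y ⬝ᵥ H.mulVec y + (b + (2:ℝ) • H.mulVec (m k)) ⬝ᵥ y) *
          (y ⬝ᵥ H.mulVec y + (b + (2:ℝ) • H.mulVec (m k)) ⬝ᵥ y) * exp (-At k y)) / (∫ y, exp (-At k y)) -
        (∫ y, (y ⬝ᵥ H.mulVec y + (b + (2:ℝ) • H.mulVec (m k)) ⬝ᵥ y) * exp (-At k y)) / (∫ y, exp (-At k y)) *
          ((∫ y, (y ⬝ᵥ H.mulVec y + (b + (2:ℝ) • H.mulVec (m k)) ⬝ᵥ y) * exp (-At k y)) / (∫ y, exp (-At k y)))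
      = (∫ x, q x * q x * exp (-Am k x)) / (∫ x, exp (-Am k x)) -
        (∫ x, q x * exp (-Am k x)) / (∫ x, exp (-Am k x)) *
          ((∫ x, q x * exp (-Am k x)) / (∫ x, exp (-Am k x))) := by
    intro k
    set c : ℝ := b ⬝ᵥ m k + H.mulVec (m k) ⬝ᵥ m k with hc
    -- the shifted observable is `q(· + m) − c`... precisely `q_k(y) = q(y + m_k) − c`
    have hqk : ∀ y, y ⬝ᵥ H.mulVec y + (b + (2:ℝ) • H.mulVec (m k)) ⬝ᵥ y = q (y + m k) - c := by
      intro y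
      simp only [hqdef, hc, Matrix.mulVec_add, add_dotProduct, dotProduct_add, smul_dotProduct, smul_eq_mul]
      have e1 : y ⬝ᵥ H.mulVec (m k) = H.mulVec (m k) ⬝ᵥ y := by
        rw [dotProduct_mulVec_of_isSymm hH y (m k), dotProduct_comm]
        rw [← dotProduct_mulVec_of_isSymm hH (m k) y]
      have e2 : m k ⬝ᵥ H.mulVec y = H.mulVec (m k) ⬝ᵥ y := dotProduct_mulVec_of_isSymm hH (m k) y
      have e3 : b ⬝ᵥ m k = m k ⬝ᵥ b := dotProduct_comm _ _
      have e4 : m k ⬝ᵥ H.mulVec (m k) = H.mulVec (m k) ⬝ᵥ m k := dotProduct_mulVec_of_isSymm hH (m k) (m k)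
      rw [e1, e2, e4]
      ring
    -- translate the three integrals
    have T0 : ∫ y, exp (-At k y) = ∫ x, exp (-Am k x) :=
      integral_add_right_eq_self (μ := (volume : Measure (Fin n → ℝ))) (fun x => exp (-Am k x)) (m k)
    have T1 : ∫ y, (y ⬝ᵥ H.mulVec y + (b + (2:ℝ) • H.mulVec (m k)) ⬝ᵥ y) * exp (-At k y) =
        ∫ x, (q x - c) * exp (-Am k x) := by
      simp only [hqk, hAtdef]
      exact integral_add_right_eq_self (μ := (volume : Measure (Fin n → ℝ)))
        (fun x => (q x - c) * exp (-Am k x)) (m k)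
    have T2 : ∫ y, (y ⬝ᵥ H.mulVec y + (b + (2:ℝ) • H.mulVec (m k)) ⬝ᵥ y) *
        (y ⬝ᵥ H.mulVec y + (b + (2:ℝ) • H.mulVec (m k)) ⬝ᵥ y) * exp (-At k y) =
        ∫ x, (q x - c) * (q x - c) * exp (-Am k x) := by
      simp only [hqk, hAtdef]
      exact integral_add_right_eq_self (μ := (volume : Measure (Fin n → ℝ)))
        (fun x => (q x - c) * (q x - c) * exp (-Am k x)) (m k)
    rw [T0, T1, T2]
    -- expand the shifted moments
    have hI0 : Integrable fun x => exp (-Am k x) := by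
      have := integrable_mul_exp_neg_of_growth (hAmc k) continuous_const hκ (by norm_num : 0 ≤ 8) (hlbm k)
        (w := fun _ => (1:ℝ)) (D := 1) (fun x => by simp)
      simpa using this
    have hI1 : Integrable fun x => q x * exp (-Am k x) :=
      integrable_mul_exp_neg_of_growth (hAmc k) hqc hκ (by norm_num) (hlbm k) hqb
    have hI2 : Integrable fun x => q x * q x * exp (-Am k x) :=
      integrable_mul_exp_neg_of_growth (hAmc k) (hqc.mul hqc) hκ (by norm_num) (hlbm k) hqqb
    have e1 : (fun x => (q x - c) * exp (-Am k x)) = fun x => q x * exp (-Am k x) - c * exp (-Am k x) := by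
      funext x; ring
    have e2 : (fun x => (q x - c) * (q x - c) * exp (-Am k x)) =
        fun x => q x * q x * exp (-Am k x) - (2 * c) * (q x * exp (-Am k x)) + c ^ 2 * exp (-Am k x) := by
      funext x; ring
    have hI12 : Integrable fun x => q x * q x * exp (-Am k x) - (2 * c) * (q x * exp (-Am k x)) :=
      hI2.sub (hI1.const_mul _)
    rw [e1, e2, integral_sub hI1 (hI0.const_mul _), integral_const_mul,
      integral_add hI12 (hI0.const_mul _), integral_sub hI2 (hI1.const_mul _), integral_const_mul,
      integral_const_mul]
    rw [show (2 * c) * ∫ x, q x * exp (-Am k x) = 2 * c * ∫ x, q x * exp (-Am k x) from rfl]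
    exact var_ratio_shift (hZk k).ne' c
  -- the floor for each `k`, in terms of `q` and `A_k`
  have hk : ∀ k, (∫ x, q x * q x * exp (-Am k x)) / (∫ x, exp (-Am k x)) -
        (∫ x, q x * exp (-Am k x)) / (∫ x, exp (-Am k x)) *
          ((∫ x, q x * exp (-Am k x)) / (∫ x, exp (-Am k x))) ≤
      (1 + 26 * δ) * (2 * (H * H).trace + (b + (2:ℝ) • H.mulVec (m k)) ⬝ᵥ (b + (2:ℝ) • H.mulVec (m k))) :=
    fun k => by
    have h := hceil k
    rw [hident k] at h
    exact h
  -- pass to the limit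
  have hL : Tendsto (fun k => (1 + 26 * δ) * (2 * (H * H).trace +
      (b + (2:ℝ) • H.mulVec (m k)) ⬝ᵥ (b + (2:ℝ) • H.mulVec (m k)))) atTop
      (𝓝 ((1 + 26 * δ) * (2 * (H * H).trace + b ⬝ᵥ b))) := by
    have hcont : Continuous fun v : Fin n → ℝ => (1 + 26 * δ) * (2 * (H * H).trace +
        (b + (2:ℝ) • H.mulVec v) ⬝ᵥ (b + (2:ℝ) • H.mulVec v)) := by
      have h1 : Continuous fun v : Fin n → ℝ => H.mulVec v :=
        (Matrix.mulVecLin H).toContinuousLinearMap.continuous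
      have hv : Continuous fun v : Fin n → ℝ => b + (2:ℝ) • H.mulVec v :=
        continuous_const.add (h1.const_smul (2:ℝ))
      exact continuous_const.mul (continuous_const.add (hv.dotProduct hv))
    have := (hcont.tendsto 0).comp hmlim
    simp only [Matrix.mulVec_zero, smul_zero, add_zero] at this
    exact this
  have hR : Tendsto (fun k => (∫ x, q x * q x * exp (-Am k x)) / (∫ x, exp (-Am k x)) -
      (∫ x, q x * exp (-Am k x)) / (∫ x, exp (-Am k x)) *
        ((∫ x, q x * exp (-Am k x)) / (∫ x, exp (-Am k x)))) atTop
      (𝓝 ((∫ x, q x * q x * exp (-A x)) / (∫ x, exp (-A x)) -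
        (∫ x, q x * exp (-A x)) / (∫ x, exp (-A x)) * ((∫ x, q x * exp (-A x)) / (∫ x, exp (-A x))))) :=
    (hIqqlim.div hZlim hZ.ne').sub ((hIqlim.div hZlim hZ.ne').mul (hIqlim.div hZlim hZ.ne'))
  exact le_of_tendsto_of_tendsto' hR hL hk

end Summit.QuantumFields.YangMills.Theorems.SandwichVariancePinching

end
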